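import Literature.Probability.LatticeModels.DobrushinShlosmanComparison
import Mathlib.Analysis.SpecificLimits.Basic
import HarnessLib

/-!
# The Dobrushin–Shlosman window comparison under a WEIGHTED received-sum condition (abstract part)

Companion of `DobrushinShlosmanComparison.lean` (estimates, the single-window update and the averaged step
`step a x = (1 - ε|U|/|ι|) a x + (ε/|ι|) Σ_{c ∈ U} upd_c a x` of the Dobrushin–Shlosman window comparison in the
Vasserstein form) and `DobrushinShlosmanContraction.lean` (its contraction along an `ℕ`-valued PROFILE that
drops by at most one along the support of the influence array `k c y x`; boundary cell `y`, interior cell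
`x ∈ win c`). The profile form needs a FINITE influence radius: when every cell influences every window
(quasi-local, infinite-range interactions on a finite torus) an adapted profile is `≤ 1` and gives no decay.

The remedy printed for Dobrushin's one-site technique — Georgii's Remark 8.26 / Künsch's weighted row-sum
condition / Föllmer's Corollary (2.14) ("following L. Gross") — carries over verbatim to overlapping WINDOWS
(the tree has it for sites, `DobrushinMetricWeightedDecay.lean`, and for cells-as-windows,
`DobrushinCellWeightedDecay.lean`): if, besides the plain per-window received sums `Σ_y k c y x ≤ γ₀ ≤ 1` on
the usable windows, a weight `θ ≥ 0` with `θ ≥ 1` on the cells covered by no usable window satisfies the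
WEIGHTED per-window condition `Σ_y k c y x · θ y ≤ γ₀ · θ x` (`c` usable, `x ∈ win c`), then the iterates of
the averaged step started at the constant vector `R` stay below `R (bⁿ + θ x)`, `b = 1 - ε(1-γ₀)/|ι|`
(`iterate_step_le_window_weighted`; no laziness budget is needed, the boundary layer is absorbed by `θ ≥ 1`),
so two functionals invariant under the usable window operators differ on an admissible `F` by at most
`R Σ_x θ x δ_x(F)` (`abs_sub_le_window_weighted`). With `θ x = e^{-t ρ(x)}` for a distance-like profile `ρ`
this is exponential decay WITHOUT any range hypothesis on `k` (`DobrushinShlosmanWeightedStates.lean`).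

Theorems only (no definition, no named fact); finite cell type `ι`.

## References

* H.-O. Georgii, *Gibbs Measures and Phase Transitions*, 2nd ed. (2011), Thm. 8.20, Remark 8.26, §8.2.
* H. Künsch, *Decay of correlations under Dobrushin's uniqueness condition and its applications*,
  Comm. Math. Phys. 84 (1982) 207–222.
* H. Föllmer, *Random fields and diffusion processes*, LNM 1362 (1988), Ch. I §2: Lemma (2.5),
  Comparison Theorem (2.8), Cor. (2.14).
* R. L. Dobrushin, S. B. Shlosman, *Constructive criterion for the uniqueness of Gibbs field* (1985), Thm. 1.
-/

open Finset Filter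

noncomputable section

namespace Literature.Probability.LatticeModels.DobrushinShlosman

variable {ι Ω : Type*} [Fintype ι] [DecidableEq ι]
variable {R : ℝ} {Adm : (Ω → ℝ) → Prop} {Lip : (Ω → ℝ) → (ι → ℝ) → Prop} {T : ι → (Ω → ℝ) → (Ω → ℝ)}
  {win : ι → Finset ι} {k : ι → ι → ι → ℝ} {U : Finset ι} {E₁ E₂ : (Ω → ℝ) → ℝ}

/-! ### The averaged step: a sup bound and the frozen cells -/

/-- **The averaged step does not increase the sup** when the usable windows have plain received sums
`Σ_y k c y x ≤ γ₀ ≤ 1`: a vector `0 ≤ a ≤ R` is mapped to a vector `≤ R` (every single-window update of `a`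
is `≤ R`, and the step is a convex combination). [folklore] -/
private theorem step_le_of_le (hk : ∀ c y x, 0 ≤ k c y x) {ε : ℝ} (hε0 : 0 ≤ ε) (hε1 : ε ≤ 1)
    {step : (ι → ℝ) → ι → ℝ} (hstep : ∀ a x, step a x = (1 - ε * U.card / Fintype.card ι) * a x +
      ε / Fintype.card ι * ∑ c ∈ U, (if x ∈ win c then ∑ y, k c y x * a y else a x))
    {γ₀ : ℝ} (hγ₁ : γ₀ ≤ 1) (hsumU : ∀ c ∈ U, ∀ x ∈ win c, ∑ y, k c y x ≤ γ₀)
    (hR : 0 ≤ R) {a : ι → ℝ} (ha : ∀ x, a x ≤ R) (x : ι) : step a x ≤ R := by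
  have hupd : ∀ c ∈ U, (if x ∈ win c then ∑ y, k c y x * a y else a x) ≤ R := by
    intro c hc
    split_ifs with hx
    · calc ∑ y, k c y x * a y ≤ ∑ y, k c y x * R :=
            Finset.sum_le_sum fun y _ => mul_le_mul_of_nonneg_left (ha y) (hk c y x)
        _ = (∑ y, k c y x) * R := by rw [Finset.sum_mul]
        _ ≤ 1 * R := mul_le_mul_of_nonneg_right ((hsumU c hc x hx).trans hγ₁) hR
        _ = R := one_mul R
    · exact ha x
  have hw := step_weight_nonneg U hε1 (ι := ι)
  have hq : 0 ≤ ε / Fintype.card ι := div_nonneg hε0 (Nat.cast_nonneg _)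
  rw [hstep]
  calc (1 - ε * U.card / Fintype.card ι) * a x +
        ε / Fintype.card ι * ∑ c ∈ U, (if x ∈ win c then ∑ y, k c y x * a y else a x)
      ≤ (1 - ε * U.card / Fintype.card ι) * R + ε / Fintype.card ι * ∑ c ∈ U, R :=
        add_le_add (mul_le_mul_of_nonneg_left (ha x) hw)
          (mul_le_mul_of_nonneg_left (Finset.sum_le_sum hupd) hq)
    _ = R := by rw [Finset.sum_const, nsmul_eq_mul]; ring

/-- All iterates of the averaged step started at the constant `R ≥ 0` stay `≤ R` (plain received sums
`≤ γ₀ ≤ 1` on the usable windows). [folklore] -/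
private theorem iterate_step_le_self (hk : ∀ c y x, 0 ≤ k c y x) {ε : ℝ} (hε0 : 0 ≤ ε) (hε1 : ε ≤ 1)
    {step : (ι → ℝ) → ι → ℝ} (hstep : ∀ a x, step a x = (1 - ε * U.card / Fintype.card ι) * a x +
      ε / Fintype.card ι * ∑ c ∈ U, (if x ∈ win c then ∑ y, k c y x * a y else a x))
    {γ₀ : ℝ} (hγ₁ : γ₀ ≤ 1) (hsumU : ∀ c ∈ U, ∀ x ∈ win c, ∑ y, k c y x ≤ γ₀)
    (hR : 0 ≤ R) (m : ℕ) (x : ι) : step^[m] (fun _ => R) x ≤ R := by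
  induction m generalizing x with
  | zero => exact le_rfl
  | succ m ih =>
    rw [Function.iterate_succ_apply']
    exact step_le_of_le hk hε0 hε1 hstep hγ₁ hsumU hR ih x

/-- **A cell covered by no usable window is frozen**: `step a x = a x`. [folklore] -/
private theorem step_eq_self_of_forall_not_mem {ε : ℝ} {step : (ι → ℝ) → ι → ℝ}
    (hstep : ∀ a x, step a x = (1 - ε * U.card / Fintype.card ι) * a x +
      ε / Fintype.card ι * ∑ c ∈ U, (if x ∈ win c then ∑ y, k c y x * a y else a x))
    (a : ι → ℝ) {x : ι} (hx : ∀ c ∈ U, x ∉ win c) : step a x = a x := by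
  rw [hstep, Finset.sum_congr rfl fun c hc => if_neg (hx c hc), Finset.sum_const, nsmul_eq_mul]
  rcases Nat.eq_zero_or_pos (Fintype.card ι) with h0 | hpos
  · simp [h0]
  · have hι : (Fintype.card ι : ℝ) ≠ 0 := by exact_mod_cast hpos.ne'
    field_simp
    ring

/-! ### The weighted contraction -/

/-- **THE WEIGHTED CONTRACTION OF THE DOBRUSHIN–SHLOSMAN ITERATION** (Georgii 2011 Remark 8.26 / Künsch 1982 /
Föllmer 1988 Cor. (2.14), transported from sites to overlapping windows). Let the usable windows have plain
received sums `Σ_y k c y x ≤ γ₀ ≤ 1` and, for a weight `θ ≥ 0`, weighted received sums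
`Σ_y k c y x · θ y ≤ γ₀ · θ x` (`c ∈ U`, `x ∈ win c`), and let `θ ≥ 1` on every cell lying in no usable window.
Then for `0 ≤ ε ≤ 1` the iterates of the averaged step from the constant vector `R ≥ 0` satisfy
`(stepⁿ R) x ≤ R (bⁿ + θ x)`, `b = 1 - ε(1-γ₀)/|ι|`: on a covered cell the step contracts BOTH summands by
`1 - ε n_x (1-γ₀)/|ι| ≤ b` (`n_x ≥ 1` usable windows around `x`), on an uncovered cell the iterate is frozen at a
value `≤ R ≤ R θ x`. [cite: Georgii2011, Remark 8.26] -/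
theorem iterate_step_le_window_weighted (hR : 0 ≤ R) (hk : ∀ c y x, 0 ≤ k c y x) {γ₀ ε : ℝ}
    (hγ₀ : 0 ≤ γ₀) (hγ₁ : γ₀ ≤ 1) (hε0 : 0 ≤ ε) (hε1 : ε ≤ 1) {step : (ι → ℝ) → ι → ℝ}
    (hstep : ∀ a x, step a x = (1 - ε * U.card / Fintype.card ι) * a x +
      ε / Fintype.card ι * ∑ c ∈ U, (if x ∈ win c then ∑ y, k c y x * a y else a x))
    (hsumU : ∀ c ∈ U, ∀ x ∈ win c, ∑ y, k c y x ≤ γ₀) {θ : ι → ℝ} (hθ0 : ∀ x, 0 ≤ θ x)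
    (hθ1 : ∀ x, (∀ c ∈ U, x ∉ win c) → 1 ≤ θ x)
    (hsumθ : ∀ c ∈ U, ∀ x ∈ win c, ∑ y, k c y x * θ y ≤ γ₀ * θ x) (m : ℕ) (x : ι) :
    step^[m] (fun _ => R) x ≤ R * ((1 - ε * (1 - γ₀) / Fintype.card ι) ^ m + θ x) := by
  have hιpos : (0 : ℝ) < Fintype.card ι := by exact_mod_cast Fintype.card_pos_iff.2 ⟨x⟩
  -- the contraction factor `b ∈ [0, 1]`
  have hb0 : 0 ≤ 1 - ε * (1 - γ₀) / Fintype.card ι := by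
    rw [sub_nonneg, div_le_one hιpos]
    have h1 : ε * (1 - γ₀) ≤ 1 := by nlinarith
    exact h1.trans (by exact_mod_cast Fintype.card_pos_iff.2 ⟨x⟩)
  have hb1 : 1 - ε * (1 - γ₀) / Fintype.card ι ≤ 1 := by
    have : 0 ≤ ε * (1 - γ₀) / Fintype.card ι := div_nonneg (by nlinarith) hιpos.le
    linarith
  induction m generalizing x with
  | zero =>
    simp only [Function.iterate_zero, id_eq, pow_zero]
    nlinarith [hθ0 x]
  | succ m ih =>
    set b : ℝ := 1 - ε * (1 - γ₀) / Fintype.card ι with hbdef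
    rw [Function.iterate_succ_apply']
    set a : ι → ℝ := step^[m] (fun _ => R) with hadef
    by_cases hcov : ∃ c ∈ U, x ∈ win c
    · -- a covered cell: `n_x ≥ 1` usable windows around `x`
      set n : ℕ := (U.filter fun c => x ∈ win c).card with hndef
      have hn1 : (1 : ℝ) ≤ n := by
        obtain ⟨c, hcU, hxc⟩ := hcov
        have : 0 < n := Finset.card_pos.2 ⟨c, Finset.mem_filter.2 ⟨hcU, hxc⟩⟩
        exact_mod_cast this
      have hnU : (n : ℝ) ≤ U.card := by exact_mod_cast Finset.card_filter_le U _
      have hUι : (U.card : ℝ) ≤ Fintype.card ι := by exact_mod_cast Finset.card_le_univ U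
      set B : ℝ := b ^ m + θ x with hBdef
      have hB0 : 0 ≤ R * B := mul_nonneg hR (add_nonneg (pow_nonneg hb0 m) (hθ0 x))
      -- each usable window around `x` contributes at most `R γ₀ B`, each other usable centre `R B`
      have hupd : ∀ c ∈ U, (if x ∈ win c then ∑ y, k c y x * a y else a x) ≤
          (if x ∈ win c then R * γ₀ * B else R * B) := by
        intro c hc
        split_ifs with hxc
        · calc ∑ y, k c y x * a y ≤ ∑ y, k c y x * (R * (b ^ m + θ y)) :=
                Finset.sum_le_sum fun y _ => mul_le_mul_of_nonneg_left (ih y) (hk c y x)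
            _ = R * (b ^ m * ∑ y, k c y x + ∑ y, k c y x * θ y) := by
                rw [Finset.mul_sum, ← Finset.sum_add_distrib, Finset.mul_sum]
                exact Finset.sum_congr rfl fun y _ => by ring
            _ ≤ R * (b ^ m * γ₀ + γ₀ * θ x) :=
                mul_le_mul_of_nonneg_left (add_le_add (mul_le_mul_of_nonneg_left (hsumU c hc x hxc)
                  (pow_nonneg hb0 m)) (hsumθ c hc x hxc)) hR
            _ = R * γ₀ * B := by rw [hBdef]; ring
        · exact ih x
      have hsum_upd : ∑ c ∈ U, (if x ∈ win c then ∑ y, k c y x * a y else a x) ≤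
          n * (R * γ₀ * B) + ((U.card : ℝ) - n) * (R * B) := by
        refine (Finset.sum_le_sum hupd).trans (le_of_eq ?_)
        rw [Finset.sum_ite, Finset.sum_const, Finset.sum_const, nsmul_eq_mul, nsmul_eq_mul, ← hndef]
        have hcard : ((U.filter fun c => ¬x ∈ win c).card : ℝ) = (U.card : ℝ) - n := by
          have h := Finset.card_filter_add_card_filter_not (s := U) (fun c => x ∈ win c)
          rw [← hndef] at h
          have h' : ((n : ℕ) : ℝ) + ((U.filter fun c => ¬x ∈ win c).card : ℝ) = U.card := by
            exact_mod_cast h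
          linarith
        rw [hcard]
      have hw := step_weight_nonneg U hε1 (ι := ι)
      have hq : 0 ≤ ε / Fintype.card ι := div_nonneg hε0 hιpos.le
      rw [hstep]
      calc (1 - ε * U.card / Fintype.card ι) * a x +
            ε / Fintype.card ι * ∑ c ∈ U, (if x ∈ win c then ∑ y, k c y x * a y else a x)
          ≤ (1 - ε * U.card / Fintype.card ι) * (R * B) +
              ε / Fintype.card ι * (n * (R * γ₀ * B) + ((U.card : ℝ) - n) * (R * B)) :=
            add_le_add (mul_le_mul_of_nonneg_left (ih x) hw) (mul_le_mul_of_nonneg_left hsum_upd hq)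
        _ = R * B * (1 - ε * (n * (1 - γ₀)) / Fintype.card ι) := by
            field_simp
            ring
        _ ≤ R * B * b := by
            refine mul_le_mul_of_nonneg_left ?_ hB0
            rw [hbdef]
            have h1 : ε * (1 - γ₀) ≤ ε * (n * (1 - γ₀)) :=
              mul_le_mul_of_nonneg_left (le_mul_of_one_le_left (sub_nonneg.2 hγ₁) hn1) hε0
            have h2 := div_le_div_of_nonneg_right h1 hιpos.le
            linarith
        _ = R * b ^ (m + 1) + R * θ x * b := by rw [hBdef, pow_succ]; ring
        _ ≤ R * (b ^ (m + 1) + θ x) := by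
            rw [mul_add]
            nlinarith [mul_nonneg hR (hθ0 x)]
    · -- an uncovered cell is frozen at a value `≤ R ≤ R θ x`
      simp only [not_exists, not_and] at hcov
      rw [step_eq_self_of_forall_not_mem hstep a hcov, hadef]
      have h1 := iterate_step_le_self hk hε0 hε1 hstep hγ₁ hsumU hR m x
      have h2 := hθ1 x hcov
      nlinarith [pow_nonneg hb0 (m + 1)]

/-! ### The comparison estimate -/

/-- **The Dobrushin–Shlosman window comparison under the weighted received-sum condition** (Dobrushin–Shlosman
1985 Thm. 1 run with Georgii's Remark 8.26 / Künsch's weights): for two monotone-normalised functionals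
invariant under the window operators of the usable centres `U`, window dusting data (`hdust`), plain per-window
received sums `≤ γ₀ < 1` and `θ`-weighted per-window received sums `≤ γ₀ θ x` on the usable windows, and a weight
`θ ≥ 0` with `θ ≥ 1` on the cells in no usable window, every admissible `F` with Lipschitz vector `δ` satisfies
`|E₁ F - E₂ F| ≤ R Σ_x θ x δ x` (the iterates `≤ R (bⁿ + θ)` of `iterate_step_le_window_weighted` with `ε = 1`,
`b = 1 - (1-γ₀)/|ι| < 1`, and `n → ∞`). [cite: Georgii2011, Remark 8.26]
[cite: DobrushinShlosman1985, Theorem] -/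
theorem abs_sub_le_window_weighted (hR : 0 ≤ R)
    (hlip0 : ∀ ⦃F : Ω → ℝ⦄ ⦃δ : ι → ℝ⦄, Lip F δ → ∀ x, 0 ≤ δ x)
    (hosc : ∀ ⦃F : Ω → ℝ⦄ ⦃δ : ι → ℝ⦄, Adm F → Lip F δ → ∀ σ τ, |F σ - F τ| ≤ R * ∑ x, δ x)
    (hk : ∀ c y x, 0 ≤ k c y x) (hT : ∀ ⦃F : Ω → ℝ⦄ (c : ι), Adm F → Adm (T c F))
    (hdust : ∀ ⦃F : Ω → ℝ⦄ ⦃δ : ι → ℝ⦄ (c : ι), Adm F → Lip F δ →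
      Lip (T c F) fun y => if y ∈ win c then 0 else δ y + ∑ x ∈ win c, k c y x * δ x)
    (h₁le : ∀ ⦃F : Ω → ℝ⦄ ⦃M : ℝ⦄, Adm F → (∀ σ, F σ ≤ M) → E₁ F ≤ M)
    (h₁ge : ∀ ⦃F : Ω → ℝ⦄ ⦃M : ℝ⦄, Adm F → (∀ σ, M ≤ F σ) → M ≤ E₁ F)
    (h₁T : ∀ ⦃F : Ω → ℝ⦄ (c : ι), c ∈ U → Adm F → E₁ (T c F) = E₁ F)
    (h₂le : ∀ ⦃F : Ω → ℝ⦄ ⦃M : ℝ⦄, Adm F → (∀ σ, F σ ≤ M) → E₂ F ≤ M)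
    (h₂ge : ∀ ⦃F : Ω → ℝ⦄ ⦃M : ℝ⦄, Adm F → (∀ σ, M ≤ F σ) → M ≤ E₂ F)
    (h₂T : ∀ ⦃F : Ω → ℝ⦄ (c : ι), c ∈ U → Adm F → E₂ (T c F) = E₂ F)
    {γ₀ : ℝ} (hγ₀ : 0 ≤ γ₀) (hγ₁ : γ₀ < 1) (hsumU : ∀ c ∈ U, ∀ x ∈ win c, ∑ y, k c y x ≤ γ₀)
    {θ : ι → ℝ} (hθ0 : ∀ x, 0 ≤ θ x) (hθ1 : ∀ x, (∀ c ∈ U, x ∉ win c) → 1 ≤ θ x)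
    (hsumθ : ∀ c ∈ U, ∀ x ∈ win c, ∑ y, k c y x * θ y ≤ γ₀ * θ x)
    ⦃F : Ω → ℝ⦄ ⦃δ : ι → ℝ⦄ (hF : Adm F) (hδ : Lip F δ) :
    |E₁ F - E₂ F| ≤ R * ∑ x, θ x * δ x := by
  set step : (ι → ℝ) → ι → ℝ := fun a x => (1 - 1 * U.card / Fintype.card ι) * a x +
    1 / Fintype.card ι * ∑ c ∈ U, (if x ∈ win c then ∑ y, k c y x * a y else a x) with hstepdef
  have hstep : ∀ a x, step a x = (1 - 1 * U.card / Fintype.card ι) * a x +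
      1 / Fintype.card ι * ∑ c ∈ U, (if x ∈ win c then ∑ y, k c y x * a y else a x) := fun _ _ => rfl
  set b : ℝ := 1 - 1 * (1 - γ₀) / Fintype.card ι with hbdef
  have hδ0 := hlip0 hδ
  -- the estimate after `m` averaged steps, bounded by the weighted profile
  have hB : ∀ m : ℕ, |E₁ F - E₂ F| ≤ R * b ^ m * ∑ x, δ x + R * ∑ x, θ x * δ x := fun m => by
    refine (iterate_estimate hR hlip0 hosc hk hT hdust h₁le h₁ge h₁T h₂le h₂ge h₂T zero_le_one le_rfl hstep m
      hF hδ).trans ?_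
    rw [Finset.mul_sum, Finset.mul_sum, ← Finset.sum_add_distrib]
    refine Finset.sum_le_sum fun x _ => ?_
    have h1 := iterate_step_le_window_weighted hR hk hγ₀ hγ₁.le zero_le_one le_rfl hstep hsumU hθ0 hθ1 hsumθ m x
    have h2 : step^[m] (fun _ => R) x * δ x ≤ R * (b ^ m + θ x) * δ x := mul_le_mul_of_nonneg_right h1 (hδ0 x)
    refine h2.trans (le_of_eq ?_)
    ring
  -- `b ∈ [0, 1)` unless `ι` is empty (then every sum vanishes)
  rcases isEmpty_or_nonempty ι with hι | hι
  · have h := hB 0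
    simp only [Finset.univ_eq_empty, Finset.sum_empty, mul_zero, add_zero] at h
    simpa using h
  have hιpos : (0 : ℝ) < Fintype.card ι := by exact_mod_cast Fintype.card_pos
  have hb0 : 0 ≤ b := by
    rw [hbdef, sub_nonneg, div_le_one hιpos, one_mul]
    have h1 : (1 : ℝ) ≤ Fintype.card ι := by exact_mod_cast Fintype.card_pos
    linarith
  have hb1 : b < 1 := by
    rw [hbdef, one_mul]
    have : 0 < (1 - γ₀) / Fintype.card ι := div_pos (by linarith) hιpos
    linarith
  have hlim : Tendsto (fun m : ℕ => R * b ^ m * ∑ x, δ x + R * ∑ x, θ x * δ x) atTop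
      (nhds (R * 0 * ∑ x, δ x + R * ∑ x, θ x * δ x)) :=
    ((((tendsto_pow_atTop_nhds_zero_of_lt_one hb0 hb1).const_mul R).mul_const _).add_const _)
  have h := ge_of_tendsto' hlim hB
  simpa using h

end Literature.Probability.LatticeModels.DobrushinShlosman

end
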